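import Mathlib
import HarnessLib
import Summits.AtomisticToContinuum.FouriersLaw.Theses.JunctionLocality
import Summits.AtomisticToContinuum.FouriersLaw.Theorems.JunctionLocalitySuperadditiveResistanceKuboReversal

/-!
# Kubo–Onsager for the γ-thermostatted pinned chain, VI: Gaussian integration by parts in one momentum

Helper file (`--supports` stmt-AtomisticToContinuum-11748) for stub `stub_kuboOnsager` of the line
`floating-probe-bypass-laplacian` (crux `JunctionLocality.SuperadditiveResistance`). Under `e^{-H/T} dq dp` each
momentum is a centred Gaussian of variance `T`, independent of everything else; the only consequence needed
downstream is the integration-by-parts identity, for NON-compactly-supported `F ∈ C¹` with `F, ∂_{p_i}F ∈ L²(μ_T)`: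

* `gauss_ibp` — `∫ (p_i² − T) F ρ = T ∫ p_i ∂_{p_i} F ρ` (cutoff `χ_n`, compact integration by parts against
  `∂_{p_i} e^{-H/T} = −(p_i/T) e^{-H/T}`, then `n → ∞` with part I's dominated-convergence lemmas);
* moments: `∫ (p_i² − T) ρ = 0`, `∫ p_i² ρ = T ∫ ρ`, `∫ (p_i² − T) H ρ = T² ∫ ρ`;
* square integrability of `p_i`, `p_i² − T`, `H` for `μ_T` (`memLp_two_of_sq_le_exp`: anything with `F² ≤ C e^{H/(2T)}`).
References: folklore (Gaussian integration by parts / Stein's identity).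
-/

noncomputable section

open MeasureTheory Filter Topology ProbabilityTheory
open scoped ContDiff NNReal ENNReal
open Literature.MathematicalPhysics.KineticTheory.HeatConduction
open Summit.AtomisticToContinuum.FouriersLaw.Theorems.SuperadditiveResistance.DeviceLiouville

namespace Summit.AtomisticToContinuum.FouriersLaw.Theorems.SuperadditiveResistance.Kubo

section Gauss

variable {ω₂ lam β γ : ℝ} {L : ℕ}

set_option hygiene false in
/-- Local shorthand for the pinned chain of this section. -/
local notation "𝐏" => pinnedChain ω₂ lam β γ

/-! ### Square integrability of polynomially bounded observables -/

/-- A continuous `F` with `F² ≤ C e^{H/(2T)}` is in `L²(μ_T)` (`T > 0`). [folklore] -/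
theorem memLp_two_of_sq_le_exp (hω : 0 < ω₂) (hl : 0 ≤ lam) (hβ : 0 ≤ β) (L : ℕ) {T : ℝ} (hT : 0 < T)
    {F : PhaseSpace L → ℝ} (hFc : Continuous F) {C : ℝ}
    (hle : ∀ x, F x ^ 2 ≤ C * Real.exp (1 / (2 * T) * (𝐏).hamiltonian L x)) :
    MemLp F 2 ((𝐏).gibbsMeasure L T) := by
  refine memLp_of_integrable_sq_mul_gibbsDensity hω hl hβ γ L hT hFc ?_
  have hϑ : 1 / (2 * T) < 1 / T := by
    rw [one_div_lt_one_div (by positivity) hT]; linarith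
  have hmaj := (pinnedChain_integrable_exp_mul_gibbsDensity hω hl hβ γ L hT hϑ).const_mul C
  refine hmaj.mono' ((hFc.pow 2).mul (pinnedChain_continuous_gibbsDensity ω₂ lam β γ L T)).aestronglyMeasurable
    (ae_of_all _ fun x => ?_)
  have hρ := ((𝐏).gibbsDensity_pos L T x).le
  rw [Real.norm_eq_abs, abs_mul, abs_of_nonneg (sq_nonneg _), abs_of_nonneg hρ, ← mul_assoc]
  exact mul_le_mul_of_nonneg_right (hle x) hρ

/-- `(1 + H)² ≤ C e^{H/(2T)}` with an explicit constant. [folklore] -/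
theorem one_add_hamiltonian_sq_le (hω : 0 < ω₂) (hl : 0 ≤ lam) (hβ : 0 ≤ β) (L : ℕ) {T : ℝ} (hT : 0 < T)
    (x : PhaseSpace L) :
    (1 + (𝐏).hamiltonian L x) ^ 2 ≤
      2 * Real.exp (1 / (2 * T)) / (1 / (2 * T)) ^ 2 * Real.exp (1 / (2 * T) * (𝐏).hamiltonian L x) :=
  one_add_sq_le_exp (pinnedChain_hamiltonian_nonneg hω.le hl hβ γ L x) (by positivity)

/-- `p_i ∈ L²(μ_T)`. [folklore] -/
theorem memLp_momentum (hω : 0 < ω₂) (hl : 0 ≤ lam) (hβ : 0 ≤ β) (L : ℕ) {T : ℝ} (hT : 0 < T) (i : Fin L) :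
    MemLp (fun x : PhaseSpace L => x.2 i) 2 ((𝐏).gibbsMeasure L T) := by
  refine memLp_two_of_sq_le_exp hω hl hβ L hT (by fun_prop)
    (C := 2 * (2 * Real.exp (1 / (2 * T)) / (1 / (2 * T)) ^ 2)) fun x => ?_
  have h1 := pinnedChain_sq_le_two_mul_hamiltonian hω.le hl hβ γ L x i
  have h2 := one_add_hamiltonian_sq_le (γ := γ) hω hl hβ L hT x
  have hH := pinnedChain_hamiltonian_nonneg hω.le hl hβ γ L x
  nlinarith [Real.exp_pos (1 / (2 * T) * (𝐏).hamiltonian L x)]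

/-- `p_i² − T ∈ L²(μ_T)`. [folklore] -/
theorem memLp_kinetic (hω : 0 < ω₂) (hl : 0 ≤ lam) (hβ : 0 ≤ β) (L : ℕ) {T : ℝ} (hT : 0 < T) (i : Fin L) :
    MemLp (fun x : PhaseSpace L => x.2 i ^ 2 - T) 2 ((𝐏).gibbsMeasure L T) := by
  refine memLp_two_of_sq_le_exp hω hl hβ L hT (by fun_prop)
    (C := (2 + T) ^ 2 * (2 * Real.exp (1 / (2 * T)) / (1 / (2 * T)) ^ 2)) fun x => ?_
  have h1 := pinnedChain_sq_le_two_mul_hamiltonian hω.le hl hβ γ L x i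
  have h2 := one_add_hamiltonian_sq_le (γ := γ) hω hl hβ L hT x
  have hH := pinnedChain_hamiltonian_nonneg hω.le hl hβ γ L x
  set H := (𝐏).hamiltonian L x with hHdef
  have h3 : (x.2 i ^ 2 - T) ^ 2 ≤ (2 + T) ^ 2 * (1 + H) ^ 2 := by
    have ha : |x.2 i ^ 2 - T| ≤ (2 + T) * (1 + H) := by
      rw [abs_le]; constructor <;> nlinarith
    calc (x.2 i ^ 2 - T) ^ 2 = |x.2 i ^ 2 - T| ^ 2 := (sq_abs _).symm
      _ ≤ ((2 + T) * (1 + H)) ^ 2 := pow_le_pow_left₀ (abs_nonneg _) ha 2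
      _ = (2 + T) ^ 2 * (1 + H) ^ 2 := by ring
  calc (x.2 i ^ 2 - T) ^ 2 ≤ (2 + T) ^ 2 * (1 + H) ^ 2 := h3
    _ ≤ (2 + T) ^ 2 * (2 * Real.exp (1 / (2 * T)) / (1 / (2 * T)) ^ 2 * Real.exp (1 / (2 * T) * H)) :=
        mul_le_mul_of_nonneg_left h2 (by positivity)
    _ = _ := by ring

/-- `H ∈ L²(μ_T)`. [folklore] -/
theorem memLp_hamiltonian (hω : 0 < ω₂) (hl : 0 ≤ lam) (hβ : 0 ≤ β) (L : ℕ) {T : ℝ} (hT : 0 < T) :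
    MemLp ((𝐏).hamiltonian L) 2 ((𝐏).gibbsMeasure L T) := by
  refine memLp_two_of_sq_le_exp hω hl hβ L hT (pinnedChain_continuous_hamiltonian ω₂ lam β γ L)
    (C := 2 * Real.exp (1 / (2 * T)) / (1 / (2 * T)) ^ 2) fun x => ?_
  have h2 := one_add_hamiltonian_sq_le (γ := γ) hω hl hβ L hT x
  have hH := pinnedChain_hamiltonian_nonneg hω.le hl hβ γ L x
  nlinarith

/-! ### Gaussian integration by parts in `p_i` -/

/-- `∂_{p_i} p_i = 1`. [folklore] -/
theorem partialP_snd_self (i : Fin L) (x : PhaseSpace L) : partialP i (fun y : PhaseSpace L => y.2 i) x = 1 := by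
  simp [partialP]

/-- **Gaussian integration by parts** against `e^{-H/T} dq dp` in the momentum `p_i`, for `F ∈ C¹` with
`F, ∂_{p_i}F ∈ L²(μ_T)` (no support or growth condition): `∫ (p_i² − T) F ρ = T ∫ p_i ∂_{p_i}F ρ`. [folklore] -/
theorem gauss_ibp (hω : 0 < ω₂) (hl : 0 ≤ lam) (hβ : 0 ≤ β) (L : ℕ) {T : ℝ} (hT : 0 < T) (i : Fin L)
    {F : PhaseSpace L → ℝ} (hF : ContDiff ℝ 1 F) (hF2 : MemLp F 2 ((𝐏).gibbsMeasure L T))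
    (hdF2 : MemLp (partialP i F) 2 ((𝐏).gibbsMeasure L T)) :
    ∫ x, (x.2 i ^ 2 - T) * F x * (𝐏).gibbsDensity L T x =
      T * ∫ x, x.2 i * partialP i F x * (𝐏).gibbsDensity L T x := by
  have hHs : ContDiff ℝ ∞ ((𝐏).hamiltonian L) :=
    (𝐏).contDiff_hamiltonian (pinnedChain_contDiff_U ω₂ lam β γ) (pinnedChain_contDiff_V ω₂ lam β γ) L
  have hHd : Differentiable ℝ ((𝐏).hamiltonian L) := hHs.differentiable (by simp)
  have hFd : Differentiable ℝ F := hF.differentiable one_ne_zero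
  have hFc : Continuous F := hF.continuous
  have hdFc : Continuous (partialP i F) := continuous_partialP hF one_ne_zero i
  have hρc : Continuous ((𝐏).gibbsDensity L T) := pinnedChain_continuous_gibbsDensity ω₂ lam β γ L T
  have hp2 : MemLp (fun x : PhaseSpace L => x.2 i) 2 ((𝐏).gibbsMeasure L T) := memLp_momentum hω hl hβ L hT i
  have hk2 : MemLp (fun x : PhaseSpace L => x.2 i ^ 2 - T) 2 ((𝐏).gibbsMeasure L T) := memLp_kinetic hω hl hβ L hT i
  -- level n: compact integration by parts with g = χ_n F p_i
  have hlevel : ∀ n : ℕ, ∫ x, chi 𝐏 L n x * ((x.2 i ^ 2 - T) * F x) * (𝐏).gibbsDensity L T x =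
      T * (∫ x, chi 𝐏 L n x * (x.2 i * partialP i F x) * (𝐏).gibbsDensity L T x) +
        T * ∫ x, partialP i (chi 𝐏 L n) x * (F x * x.2 i) * (𝐏).gibbsDensity L T x := by
    intro n
    have hχs : ContDiff ℝ ∞ (chi 𝐏 L n) := contDiff_chi hHs n
    have hχ1 : ContDiff ℝ 1 (chi 𝐏 L n) := hχs.of_le (by norm_cast)
    have hχd : Differentiable ℝ (chi 𝐏 L n) := hχ1.differentiable one_ne_zero
    have hχcont : Continuous (chi 𝐏 L n) := hχs.continuous
    have hχc : HasCompactSupport (chi 𝐏 L n) := hasCompactSupport_chi hω hl hβ γ L n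
    have hdχc : Continuous (partialP i (chi 𝐏 L n)) := continuous_partialP hχ1 one_ne_zero i
    -- the test function and its derivative
    set g : PhaseSpace L → ℝ := fun x => chi 𝐏 L n x * F x * x.2 i with hg
    set g' : PhaseSpace L → ℝ := fun x => partialP i (chi 𝐏 L n) x * F x * x.2 i +
      chi 𝐏 L n x * partialP i F x * x.2 i + chi 𝐏 L n x * F x with hg'
    have hpd : Differentiable ℝ (fun x : PhaseSpace L => x.2 i) := by fun_prop
    have hχF : Differentiable ℝ (fun y => chi 𝐏 L n y * F y) := hχd.mul hFd
    have hgd : Differentiable ℝ g := hχF.mul hpd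
    have hgc : HasCompactSupport g := (hχc.mul_right).mul_right
    have hg'c : HasCompactSupport g' :=
      (((hasCompactSupport_partialP hχd hχc i).mul_right).mul_right.add ((hχc.mul_right).mul_right)).add
        (hχc.mul_right)
    have hderiv : ∀ x, partialP i g x = g' x := by
      intro x
      simp only [hg, hg']
      rw [partialP_mul hχF hpd, partialP_mul hχd hFd, partialP_snd_self]
      ring
    have hgl : ∀ x, HasLineDerivAt ℝ g (g' x) x ((0, Pi.single i 1) : PhaseSpace L) := fun x => by
      rw [← hderiv x]; exact hasLineDerivAt_partialP hgd i x
    have hρl : ∀ x, HasLineDerivAt ℝ ((𝐏).gibbsDensity L T)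
        (-(x.2 i / T) * (𝐏).gibbsDensity L T x) x ((0, Pi.single i 1) : PhaseSpace L) := fun x =>
      (𝐏).hasLineDerivAt_gibbsDensity ((𝐏).hasLineDerivAt_hamiltonian_unitP L x i)
    have hibp := integral_mul_eq_neg_of_hasLineDerivAt (F := (𝐏).gibbsDensity L T)
      (F' := fun x => -(x.2 i / T) * (𝐏).gibbsDensity L T x) (g := g) (g' := g') hρc (by fun_prop)
      (by simp only [hg]; fun_prop) (by simp only [hg']; fun_prop) hgc hg'c hρl hgl
    -- read off: ∫ ρ g' = (1/T) ∫ p ρ g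
    have hI1 : Integrable fun x => partialP i (chi 𝐏 L n) x * (F x * x.2 i) * (𝐏).gibbsDensity L T x :=
      Continuous.integrable_of_hasCompactSupport (by fun_prop)
        (((hasCompactSupport_partialP hχd hχc i).mul_right).mul_right)
    have hI2 : Integrable fun x => chi 𝐏 L n x * (x.2 i * partialP i F x) * (𝐏).gibbsDensity L T x :=
      Continuous.integrable_of_hasCompactSupport (by fun_prop) ((hχc.mul_right).mul_right)
    have hI3 : Integrable fun x => chi 𝐏 L n x * F x * (𝐏).gibbsDensity L T x :=
      Continuous.integrable_of_hasCompactSupport (by fun_prop) ((hχc.mul_right).mul_right)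
    have hI4 : Integrable fun x => chi 𝐏 L n x * (x.2 i ^ 2 * F x) * (𝐏).gibbsDensity L T x :=
      Continuous.integrable_of_hasCompactSupport (by fun_prop) ((hχc.mul_right).mul_right)
    have hI12 : Integrable fun x => partialP i (chi 𝐏 L n) x * (F x * x.2 i) * (𝐏).gibbsDensity L T x +
        chi 𝐏 L n x * (x.2 i * partialP i F x) * (𝐏).gibbsDensity L T x := hI1.add hI2
    have hL : ∫ x, (𝐏).gibbsDensity L T x * g' x =
        (∫ x, partialP i (chi 𝐏 L n) x * (F x * x.2 i) * (𝐏).gibbsDensity L T x) +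
          (∫ x, chi 𝐏 L n x * (x.2 i * partialP i F x) * (𝐏).gibbsDensity L T x) +
          ∫ x, chi 𝐏 L n x * F x * (𝐏).gibbsDensity L T x := by
      rw [← integral_add hI1 hI2, ← integral_add hI12 hI3]
      refine integral_congr_ae (ae_of_all _ fun x => ?_)
      simp only [hg']; ring
    have hR : -∫ x, (fun x => -(x.2 i / T) * (𝐏).gibbsDensity L T x) x * g x =
        (1 / T) * ∫ x, chi 𝐏 L n x * (x.2 i ^ 2 * F x) * (𝐏).gibbsDensity L T x := by
      rw [← integral_neg, ← integral_const_mul]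
      refine integral_congr_ae (ae_of_all _ fun x => ?_)
      simp only [hg]; field_simp
    rw [hL, hR] at hibp
    -- ∫ χ (p² − T) F ρ = ∫ χ p² F ρ − T ∫ χ F ρ
    have hsplit : ∫ x, chi 𝐏 L n x * ((x.2 i ^ 2 - T) * F x) * (𝐏).gibbsDensity L T x =
        (∫ x, chi 𝐏 L n x * (x.2 i ^ 2 * F x) * (𝐏).gibbsDensity L T x) -
          T * ∫ x, chi 𝐏 L n x * F x * (𝐏).gibbsDensity L T x := by
      rw [← integral_const_mul, ← integral_sub hI4 (hI3.const_mul T)]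
      refine integral_congr_ae (ae_of_all _ fun x => ?_)
      ring
    rw [hsplit]
    have hT0 : T ≠ 0 := hT.ne'
    have key : ∫ x, chi 𝐏 L n x * (x.2 i ^ 2 * F x) * (𝐏).gibbsDensity L T x =
        T * ((∫ x, partialP i (chi 𝐏 L n) x * (F x * x.2 i) * (𝐏).gibbsDensity L T x) +
          (∫ x, chi 𝐏 L n x * (x.2 i * partialP i F x) * (𝐏).gibbsDensity L T x) +
          ∫ x, chi 𝐏 L n x * F x * (𝐏).gibbsDensity L T x) := by
      rw [hibp]; field_simp
    rw [key]; ring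
  -- integrability of the limits
  have hI_lhs : Integrable fun x => ((x.2 i ^ 2 - T) * F x) * (𝐏).gibbsDensity L T x :=
    integrable_mul_mul_gibbsDensity hω hl hβ γ L hT hk2 hF2
  have hI_r1 : Integrable fun x => (x.2 i * partialP i F x) * (𝐏).gibbsDensity L T x :=
    integrable_mul_mul_gibbsDensity hω hl hβ γ L hT hp2 hdF2
  have hI_r2 : Integrable fun x => (F x * x.2 i) * (𝐏).gibbsDensity L T x :=
    integrable_mul_mul_gibbsDensity hω hl hβ γ L hT hF2 hp2
  have hlim_lhs := tendsto_integral_chi_mul hω.le hl hβ γ L T (F := fun x => (x.2 i ^ 2 - T) * F x)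
    (by fun_prop) hI_lhs
  have hlim_r1 := tendsto_integral_chi_mul hω.le hl hβ γ L T (F := fun x => x.2 i * partialP i F x)
    (by fun_prop) hI_r1
  have hlim_r2 := tendsto_integral_partialP_chi_mul hω hl hβ γ L T i (F := fun x => F x * x.2 i)
    (by fun_prop) hI_r2
  have hlim_rhs := (hlim_r1.const_mul T).add (hlim_r2.const_mul T)
  have heq := tendsto_nhds_unique hlim_lhs (hlim_rhs.congr fun n => (hlevel n).symm)
  rw [mul_zero, add_zero] at heq
  have e1 : ∫ x, (x.2 i ^ 2 - T) * F x * (𝐏).gibbsDensity L T x =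
      ∫ x, ((x.2 i ^ 2 - T) * F x) * (𝐏).gibbsDensity L T x := rfl
  rw [e1, heq]

/-- **Second moment of a momentum**: `∫ (p_i² − T) e^{-H/T} = 0`. [folklore] -/
theorem integral_kinetic_mul_gibbsDensity (hω : 0 < ω₂) (hl : 0 ≤ lam) (hβ : 0 ≤ β) (L : ℕ) {T : ℝ} (hT : 0 < T)
    (i : Fin L) : ∫ x, (x.2 i ^ 2 - T) * (𝐏).gibbsDensity L T x = 0 := by
  haveI := isFiniteMeasure_gibbsMeasure (pinnedChain ω₂ lam β γ) L T
  have hd1 : partialP i (fun _ : PhaseSpace L => (1 : ℝ)) = fun _ => 0 := funext fun x => partialP_const i 1 x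
  have h := gauss_ibp (γ := γ) hω hl hβ L hT i (F := fun _ => (1 : ℝ)) contDiff_const (memLp_const 1)
    (by rw [hd1]; exact memLp_const 0)
  rw [hd1] at h
  simp only [mul_one, mul_zero, zero_mul, integral_zero] at h
  exact h

/-- `∫ p_i² e^{-H/T} = T ∫ e^{-H/T}`. [folklore] -/
theorem integral_sq_mul_gibbsDensity_eq (hω : 0 < ω₂) (hl : 0 ≤ lam) (hβ : 0 ≤ β) (L : ℕ) {T : ℝ} (hT : 0 < T)
    (i : Fin L) : ∫ x, x.2 i ^ 2 * (𝐏).gibbsDensity L T x = T * ∫ x, (𝐏).gibbsDensity L T x := by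
  have h := integral_kinetic_mul_gibbsDensity (γ := γ) hω hl hβ L hT i
  have hρint : Integrable ((𝐏).gibbsDensity L T) := pinnedChain_integrable_gibbsDensity hω hl hβ γ L hT
  have hI : Integrable fun x => x.2 i ^ 2 * (𝐏).gibbsDensity L T x := by
    have := integrable_sq_mul_gibbsDensity hω hl hβ γ L hT (memLp_momentum hω hl hβ L hT i)
    exact this
  have hsplit : ∫ x, (x.2 i ^ 2 - T) * (𝐏).gibbsDensity L T x =
      (∫ x, x.2 i ^ 2 * (𝐏).gibbsDensity L T x) - T * ∫ x, (𝐏).gibbsDensity L T x := by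
    rw [← integral_const_mul, ← integral_sub hI (hρint.const_mul T)]
    refine integral_congr_ae (ae_of_all _ fun x => ?_)
    ring
  linarith

/-- **The energy–kinetic-energy covariance**: `∫ (p_i² − T) H e^{-H/T} = T² ∫ e^{-H/T}` (Gaussian integration by
parts with `F = H`, `∂_{p_i} H = p_i`). [folklore] -/
theorem integral_kinetic_mul_hamiltonian_mul_gibbsDensity (hω : 0 < ω₂) (hl : 0 ≤ lam) (hβ : 0 ≤ β) (L : ℕ)
    {T : ℝ} (hT : 0 < T) (i : Fin L) :
    ∫ x, (x.2 i ^ 2 - T) * (𝐏).hamiltonian L x * (𝐏).gibbsDensity L T x = T ^ 2 * ∫ x, (𝐏).gibbsDensity L T x := by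
  have hH1 : ContDiff ℝ 1 ((𝐏).hamiltonian L) :=
    ((𝐏).contDiff_hamiltonian (pinnedChain_contDiff_U ω₂ lam β γ) (pinnedChain_contDiff_V ω₂ lam β γ) L).of_le
      (by norm_cast)
  have hdH : partialP i ((𝐏).hamiltonian L) = fun x => x.2 i := funext fun x => (𝐏).partialP_hamiltonian L x i
  have h := gauss_ibp hω hl hβ L hT i hH1 (memLp_hamiltonian hω hl hβ L hT)
    (by rw [hdH]; exact memLp_momentum hω hl hβ L hT i)
  rw [h, hdH]
  have e : (fun x : PhaseSpace L => x.2 i * x.2 i * (𝐏).gibbsDensity L T x) =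
      fun x => x.2 i ^ 2 * (𝐏).gibbsDensity L T x := by
    funext x; ring
  simp only [e, integral_sq_mul_gibbsDensity_eq (γ := γ) hω hl hβ L hT i]
  ring

end Gauss

/-- Registered helper sub-goal `helper_kuboGaussIBP` of stub `stub_kuboOnsager` (= `gauss_ibp` in stub form; line
`floating-probe-bypass-laplacian`, crux stmt-AtomisticToContinuum-11748). [folklore] -/
theorem helper_kuboGaussIBP : ∀ {ω₂ lam β γ : ℝ}, 0 < ω₂ → 0 ≤ lam → 0 ≤ β → ∀ (L : ℕ) {T : ℝ}, 0 < T → ∀ (i : Fin L) {F : PhaseSpace L → ℝ}, ContDiff ℝ 1 F → MemLp F 2 ((pinnedChain ω₂ lam β γ).gibbsMeasure L T) → MemLp (partialP i F) 2 ((pinnedChain ω₂ lam β γ).gibbsMeasure L T) → ∫ x, (x.2 i ^ 2 - T) * F x * (pinnedChain ω₂ lam β γ).gibbsDensity L T x = T * ∫ x, x.2 i * partialP i F x * (pinnedChain ω₂ lam β γ).gibbsDensity L T x :=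
  @gauss_ibp

end Summit.AtomisticToContinuum.FouriersLaw.Theorems.SuperadditiveResistance.Kubo

end
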